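import Summits.CriticalPhenomena.SAWScalingLimit.Theses.SAWDefectDecoherence
import Summits.CriticalPhenomena.SAWScalingLimit.Theorems.SAWDefectDecoherenceConjugateClassNegligibleSums

/-!
# `DecoherenceSynthesis`: the two exponent cruxes give `ConjugateClassNegligible`

Route `SAWDefectDecoherence` of `CriticalPhenomena/SAWScalingLimit`, item
`stmt-CriticalPhenomena-8551` (`ConjugateClassNegligible`, the node) and the glue item
`stmt-CriticalPhenomena-8558` (`DecoherenceSynthesis`).

Main results:
* `conjugateClassNegligible_of_cruxes :
    BoundaryWindingRigidity → DefectDecoherence → MassRatio → ConjugateClassNegligible`;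
* `decoherenceSynthesis_proof : DecoherenceSynthesis` (the same statement, by name).

Proof (the planner's synthesis; DCS arXiv:1007.0575 §4 "we expect that in the limit the curl
vanishes" made quantitative modulo the two exponent cruxes): for a `C¹` test function `ψ` supported
in the compact `K₀ ⊆ Ω`, thicken `K₀` to a compact `K₁ = (K₀)_r ⊆ Ω`; by exhaustion every lattice
vertex whose rescaled centre lies in `K₁` belongs to `Λ_δ` eventually, so every black vertex `v`
under the support of `ψ` is `r/(2δ)`-deep. Group the black→white edge sum by black vertex:
`Σ_e ψ(δ·mid e) conj(c_w - c_v) F(e) = Σ_v ψ(δ c_v) · 2 T(v) + (Taylor term)`,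
`T(v) = Σ_{w ∼ v} conj(mid - c_v) F({v,w})` the vertex-star defect (`vertex_bound`,
`domain_bound`). `DefectDecoherence` bounds `|T(v)|` by `C (r/(2δ))^{-θ} Σ_w Z({v,w})`, the
Lipschitz bound on `ψ` bounds the Taylor term by `(L δ / 2) Σ Z`, `MassRatio` bounds `δ² Σ_{K₁} Z`
by `C' δ^{-3/4} Z(b_δ)` and `BoundaryWindingRigidity` gives `Z(b_δ) = |F(b_δ)|`; the quotient is
`O(δ^{θ-3/4} + δ^{1/4}) → 0`.
-/

noncomputable section

open scoped BigOperators Topology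
open Filter Set Metric
open Literature.Probability.LatticeModels Literature.Probability.RandomPlanarGeometry
open Literature.Probability.RandomPlanarGeometry.SAW
open Summit.CriticalPhenomena.SAWScalingLimit.Theses.SAWDefectDecoherence

namespace Summit.CriticalPhenomena.SAWScalingLimit.Theorems

namespace ConjugateClassNegligibleSynthesis

/-! ### The vertex-star estimate -/

open Classical in
/-- **Per-vertex bound.** At a black vertex `v`, the `ψ`-weighted conjugate edge sum over its
neighbours splits into `ψ(δ c_v) · 2 T(v)` (`T` the vertex-star defect, controlled by the
hypothesis `hT` when `δ c_v` lies under the support of `ψ`) plus a Taylor term controlled by the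
Lipschitz constant of `ψ`; both are bounded by the masses of the edges whose rescaled mid-point
lies in `K₁ ⊇ (tsupport ψ)_r`. [folklore] -/
theorem vertex_bound {ψ : ℂ → ℂ} {Mψ : ℝ} (hMψ : ∀ x, ‖ψ x‖ ≤ Mψ) {Lψ : NNReal}
    (hLψ : LipschitzWith Lψ ψ) {K₁ : Set ℂ} {r δ : ℝ} (hδ : 0 < δ) (hδr : δ ≤ 2 * r)
    (hK : cthickening r (tsupport ψ) ⊆ K₁)
    (F : Sym2 HexVertex → ℂ) (G : Sym2 HexVertex → ℝ) (hG : ∀ e, 0 ≤ G e)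
    (hFG : ∀ e, ‖F e‖ ≤ G e) {N : Finset HexVertex} (v : HexVertex)
    (hN : ∀ t ∈ N, hexGraph.Adj v t) {c : ℝ} (hc : 0 ≤ c)
    (hT : (δ : ℂ) * hexCenter v ∈ tsupport ψ →
      ‖∑ t ∈ N, (starRingEnd ℂ) (hexMidpoint s(v, t) - hexCenter v) * F s(v, t)‖ ≤
        c * ∑ t ∈ N, G s(v, t)) :
    ‖∑ t ∈ N, ψ ((δ : ℂ) * hexMidpoint s(v, t)) *
        (starRingEnd ℂ) (hexCenter t - hexCenter v) * F s(v, t)‖ ≤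
      (2 * Mψ * c + Lψ * δ / 2) *
        ∑ t ∈ N, (if (δ : ℂ) * hexMidpoint s(v, t) ∈ K₁ then G s(v, t) else 0) := by
  have hMψ0 : 0 ≤ Mψ := (norm_nonneg _).trans (hMψ 0)
  have hδ0 : 0 ≤ δ := hδ.le
  -- abbreviations
  set T : ℂ := ∑ t ∈ N, (starRingEnd ℂ) (hexMidpoint s(v, t) - hexCenter v) * F s(v, t) with hTdef
  set I : HexVertex → ℝ := fun t => if (δ : ℂ) * hexMidpoint s(v, t) ∈ K₁ then G s(v, t) else 0
    with hIdef
  have hI0 : ∀ t, 0 ≤ I t := fun t => by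
    simp only [hIdef]
    split_ifs
    · exact hG _
    · exact le_rfl
  -- splitting of the summand
  have hsplit : ∀ t ∈ N,
      ψ ((δ : ℂ) * hexMidpoint s(v, t)) * (starRingEnd ℂ) (hexCenter t - hexCenter v) * F s(v, t) =
        ψ ((δ : ℂ) * hexCenter v) *
            (2 * ((starRingEnd ℂ) (hexMidpoint s(v, t) - hexCenter v) * F s(v, t))) +
          (ψ ((δ : ℂ) * hexMidpoint s(v, t)) - ψ ((δ : ℂ) * hexCenter v)) *
            (starRingEnd ℂ) (hexCenter t - hexCenter v) * F s(v, t) := by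
    intro t _
    have h2 : hexCenter t - hexCenter v = 2 * (hexMidpoint s(v, t) - hexCenter v) := by
      rw [hexMidpoint_sub_hexCenter]; ring
    rw [h2, map_mul, map_ofNat]
    ring
  rw [Finset.sum_congr rfl hsplit, Finset.sum_add_distrib, ← Finset.mul_sum, ← Finset.mul_sum]
  refine (norm_add_le _ _).trans ?_
  -- the defect term
  have hA : ‖ψ ((δ : ℂ) * hexCenter v) * (2 * T)‖ ≤ 2 * Mψ * c * ∑ t ∈ N, I t := by
    by_cases hv : (δ : ℂ) * hexCenter v ∈ tsupport ψ
    · have hTle := hT hv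
      have hGI : ∑ t ∈ N, G s(v, t) = ∑ t ∈ N, I t := by
        refine Finset.sum_congr rfl fun t ht => ?_
        have hmem : (δ : ℂ) * hexMidpoint s(v, t) ∈ K₁ :=
          mem_of_dist_le_of_mem_tsupport hK hv
            ((dist_mid_center_le hδ0 (hN t ht)).trans (by linarith))
        simp only [hIdef, if_pos hmem]
      rw [hGI] at hTle
      rw [norm_mul, norm_mul, Complex.norm_two]
      have hsum0 : 0 ≤ ∑ t ∈ N, I t := Finset.sum_nonneg fun t _ => hI0 t
      calc ‖ψ ((δ : ℂ) * hexCenter v)‖ * (2 * ‖T‖)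
          ≤ Mψ * (2 * (c * ∑ t ∈ N, I t)) := by
            apply mul_le_mul (hMψ _) _ (by positivity) hMψ0
            exact mul_le_mul_of_nonneg_left hTle (by norm_num)
        _ = 2 * Mψ * c * ∑ t ∈ N, I t := by ring
    · rw [image_eq_zero_of_notMem_tsupport hv, zero_mul, norm_zero]
      exact mul_nonneg (by positivity) (Finset.sum_nonneg fun t _ => hI0 t)
  -- the Taylor term
  have hB : ‖∑ t ∈ N, (ψ ((δ : ℂ) * hexMidpoint s(v, t)) - ψ ((δ : ℂ) * hexCenter v)) *
        (starRingEnd ℂ) (hexCenter t - hexCenter v) * F s(v, t)‖ ≤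
      Lψ * δ / 2 * ∑ t ∈ N, I t := by
    rw [Finset.mul_sum]
    refine (norm_sum_le _ _).trans (Finset.sum_le_sum fun t ht => ?_)
    have hadj := hN t ht
    rw [norm_mul, norm_mul, RCLike.norm_conj]
    by_cases hmem : (δ : ℂ) * hexMidpoint s(v, t) ∈ K₁
    · have hIt : I t = G s(v, t) := by simp only [hIdef, if_pos hmem]
      rw [hIt]
      have h1 : ‖ψ ((δ : ℂ) * hexMidpoint s(v, t)) - ψ ((δ : ℂ) * hexCenter v)‖ ≤ Lψ * (δ / 2) := by
        rw [← dist_eq_norm]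
        refine (hLψ.dist_le_mul _ _).trans ?_
        exact mul_le_mul_of_nonneg_left (dist_mid_center_le hδ0 hadj) Lψ.2
      have h2 : ‖hexCenter t - hexCenter v‖ ≤ 1 := norm_hexCenter_sub_le_one hadj
      have h3 : ‖F s(v, t)‖ ≤ G s(v, t) := hFG _
      calc ‖ψ ((δ : ℂ) * hexMidpoint s(v, t)) - ψ ((δ : ℂ) * hexCenter v)‖ *
            ‖hexCenter t - hexCenter v‖ * ‖F s(v, t)‖
          ≤ Lψ * (δ / 2) * 1 * G s(v, t) := by
            apply mul_le_mul _ h3 (norm_nonneg _) (by positivity)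
            exact mul_le_mul h1 h2 (norm_nonneg _) (by positivity)
        _ = Lψ * δ / 2 * G s(v, t) := by ring
    · -- both values of `ψ` vanish
      have hmid : ψ ((δ : ℂ) * hexMidpoint s(v, t)) = 0 := by
        exact image_eq_zero_of_notMem_tsupport fun hm => hmem (hK (self_subset_cthickening _ hm))
      have hcen : ψ ((δ : ℂ) * hexCenter v) = 0 := by
        refine image_eq_zero_of_notMem_tsupport fun hv => hmem ?_
        exact mem_of_dist_le_of_mem_tsupport hK hv
          ((dist_mid_center_le hδ0 hadj).trans (by linarith))
      rw [hmid, hcen, sub_zero, norm_zero, zero_mul, zero_mul]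
      exact mul_nonneg (by positivity) (hI0 t)
  calc ‖ψ ((δ : ℂ) * hexCenter v) * (2 * T)‖ +
        ‖∑ t ∈ N, (ψ ((δ : ℂ) * hexMidpoint s(v, t)) - ψ ((δ : ℂ) * hexCenter v)) *
          (starRingEnd ℂ) (hexCenter t - hexCenter v) * F s(v, t)‖
      ≤ 2 * Mψ * c * ∑ t ∈ N, I t + Lψ * δ / 2 * ∑ t ∈ N, I t := add_le_add hA hB
    _ = (2 * Mψ * c + Lψ * δ / 2) * ∑ t ∈ N, I t := by ring


open Classical in
/-- **Domain bound.** Summing `vertex_bound` over the black vertices of `Λ`: if every vertex whose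
rescaled centre lies in `K₁ ⊇ (tsupport ψ)_r` belongs to `Λ` (exhaustion) and the vertex-star
defect at every black vertex under the support of `ψ` is at most `c` times the star mass, then the
`ψ`-weighted conjugate-class sum of the statement is at most `(2‖ψ‖_∞ c + Lip(ψ) δ/2)` times the
mass of the mid-edges whose rescaled position lies in `K₁`. [folklore] -/
theorem domain_bound {ψ : ℂ → ℂ} {Mψ : ℝ} (hMψ : ∀ x, ‖ψ x‖ ≤ Mψ) {Lψ : NNReal}
    (hLψ : LipschitzWith Lψ ψ) {K₁ : Set ℂ} {r δ : ℝ} (hδ : 0 < δ) (hδr : δ ≤ 2 * r)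
    (hK : cthickening r (tsupport ψ) ⊆ K₁)
    (F : Sym2 HexVertex → ℂ) (G : Sym2 HexVertex → ℝ) (hG : ∀ e, 0 ≤ G e)
    (hFG : ∀ e, ‖F e‖ ≤ G e) (Λ : Finset HexVertex)
    (hexδ : ∀ v : HexVertex, (δ : ℂ) * hexCenter v ∈ K₁ → v ∈ Λ) {c : ℝ} (hc : 0 ≤ c)
    (hT : ∀ v ∈ Λ, v.2 = 0 → (δ : ℂ) * hexCenter v ∈ tsupport ψ →
      ‖∑ t ∈ Λ.filter (fun t => hexGraph.Adj v t),
          (starRingEnd ℂ) (hexMidpoint s(v, t) - hexCenter v) * F s(v, t)‖ ≤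
        c * ∑ t ∈ Λ.filter (fun t => hexGraph.Adj v t), G s(v, t)) :
    ‖∑ᶠ p ∈ {p : HexVertex × HexVertex | s(p.1, p.2) ∈ hexDomainMidEdges Λ ∧ p.1.2 = 0}, ψ ((δ : ℂ) * hexMidpoint s(p.1, p.2)) *
        (starRingEnd ℂ) (hexCenter p.2 - hexCenter p.1) * F s(p.1, p.2)‖ ≤
      (2 * Mψ * c + Lψ * δ / 2) *
        ∑ᶠ e ∈ {e | e ∈ hexDomainMidEdges Λ ∧ (δ : ℂ) * hexMidpoint e ∈ K₁}, G e := by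
  have hMψ0 : 0 ≤ Mψ := (norm_nonneg _).trans (hMψ 0)
  have hpre : 0 ≤ 2 * Mψ * c + Lψ * δ / 2 := by positivity
  -- to an iterated finite sum
  have hf : ∀ p ∈ {p : HexVertex × HexVertex | s(p.1, p.2) ∈ hexDomainMidEdges Λ ∧ p.1.2 = 0}, ψ ((δ : ℂ) * hexMidpoint s(p.1, p.2)) *
      (starRingEnd ℂ) (hexCenter p.2 - hexCenter p.1) * F s(p.1, p.2) ≠ 0 → p.1 ∈ Λ ∧ p.2 ∈ Λ := by
    intro p hp hne
    have hadj : hexGraph.Adj p.1 p.2 := (SimpleGraph.mem_edgeSet _).1 hp.1.1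
    have hψ : ψ ((δ : ℂ) * hexMidpoint s(p.1, p.2)) ≠ 0 := by
      intro h0; apply hne; rw [h0, zero_mul, zero_mul]
    have hmid : (δ : ℂ) * hexMidpoint s(p.1, p.2) ∈ tsupport ψ := subset_tsupport _ hψ
    constructor
    · refine hexδ _ (mem_of_dist_le_of_mem_tsupport hK hmid ?_)
      rw [dist_comm]
      exact (dist_mid_center_le hδ.le hadj).trans (by linarith)
    · refine hexδ _ (mem_of_dist_le_of_mem_tsupport hK hmid ?_)
      rw [dist_comm]
      exact (dist_mid_center_le' hδ.le hadj).trans (by linarith)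
  rw [finsum_pairSet_eq Λ _ hf]
  calc ‖∑ v ∈ Λ.filter (fun v => v.2 = 0), ∑ t ∈ Λ.filter (fun t => hexGraph.Adj v t),
          ψ ((δ : ℂ) * hexMidpoint s(v, t)) * (starRingEnd ℂ) (hexCenter t - hexCenter v) * F s(v, t)‖
      ≤ ∑ v ∈ Λ.filter (fun v => v.2 = 0), ‖∑ t ∈ Λ.filter (fun t => hexGraph.Adj v t),
          ψ ((δ : ℂ) * hexMidpoint s(v, t)) * (starRingEnd ℂ) (hexCenter t - hexCenter v) *
            F s(v, t)‖ := norm_sum_le _ _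
    _ ≤ ∑ v ∈ Λ.filter (fun v => v.2 = 0), (2 * Mψ * c + Lψ * δ / 2) *
          ∑ t ∈ Λ.filter (fun t => hexGraph.Adj v t),
            (if (δ : ℂ) * hexMidpoint s(v, t) ∈ K₁ then G s(v, t) else 0) := by
        refine Finset.sum_le_sum fun v hv => ?_
        rw [Finset.mem_filter] at hv
        exact vertex_bound hMψ hLψ hδ hδr hK F G hG hFG v
          (fun t ht => (Finset.mem_filter.1 ht).2) hc (hT v hv.1 hv.2)
    _ = (2 * Mψ * c + Lψ * δ / 2) * ∑ v ∈ Λ.filter (fun v => v.2 = 0),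
          ∑ t ∈ Λ.filter (fun t => hexGraph.Adj v t),
            (if (δ : ℂ) * hexMidpoint s(v, t) ∈ K₁ then G s(v, t) else 0) := by
        rw [Finset.mul_sum]
    _ ≤ (2 * Mψ * c + Lψ * δ / 2) *
          ∑ᶠ e ∈ {e | e ∈ hexDomainMidEdges Λ ∧ (δ : ℂ) * hexMidpoint e ∈ K₁}, G e :=
        mul_le_mul_of_nonneg_left
          (sum_pair_indicator_le_finsum Λ G hG (fun e => (δ : ℂ) * hexMidpoint e ∈ K₁)) hpre

/-! ### The synthesis -/

/-- `δ ↦ δ ^ p → 0` as `δ → 0⁺`, for `p > 0`. [folklore] -/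
theorem tendsto_rpow_nhdsGT_zero {p : ℝ} (hp : 0 < p) :
    Tendsto (fun δ : ℝ => δ ^ p) (𝓝[>] 0) (𝓝 0) := by
  have h : Tendsto (fun δ : ℝ => δ ^ p) (𝓝 0) (𝓝 ((0 : ℝ) ^ p)) :=
    (Real.continuousAt_rpow_const 0 p (Or.inr hp.le)).tendsto
  rw [Real.zero_rpow hp.ne'] at h
  exact tendsto_nhdsWithin_of_tendsto_nhds h

end ConjugateClassNegligibleSynthesis

open ConjugateClassNegligibleSynthesis in
/-- **Decoherence synthesis** (route `SAWDefectDecoherence`, layer-1 glue): the vertex-star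
decoherence estimate `DefectDecoherence`, the positive mass comparison `MassRatio` and the boundary
winding rigidity `BoundaryWindingRigidity` together imply the node `ConjugateClassNegligible` — the
`ū`-twisted (conjugate-class) average of the `σ = 5/8` parafermionic observable against a `C¹`
bulk test function is `O(δ^{θ-3/4} + δ^{1/4}) · F_δ(b_δ) = o(F_δ(b_δ))` (this route's layer-1 glue;
conditional on the three items it consumes). -/
theorem conjugateClassNegligible_of_cruxes (hW : BoundaryWindingRigidity) (hD : DefectDecoherence)
    (hM : MassRatio) : ConjugateClassNegligible := by
  intro D ρ Λ m a b ψ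
  dsimp only
  intro hρ hflat hev hexh ha hb hψ1 hψc hψs
  obtain ⟨C_D, θ, hθ, hDD⟩ := hD
  obtain ⟨Mψ, hMψ⟩ := hψ1.continuous.bounded_above_of_compact_support hψc
  have hMψ0 : 0 ≤ Mψ := (norm_nonneg _).trans (hMψ 0)
  obtain ⟨Lψ, hLψ⟩ := hψ1.lipschitzWith_of_hasCompactSupport hψc one_ne_zero
  have hK₀ : IsCompact (tsupport ψ) := hψc
  obtain ⟨r, hr, hrsub⟩ := hK₀.exists_cthickening_subset_open D.isOpen hψs
  have hK₁ : IsCompact (cthickening r (tsupport ψ)) := hK₀.cthickening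
  have hM' := hM D ρ Λ m a b
  dsimp only at hM'
  obtain ⟨C_M, hMR⟩ := hM' hρ hflat hev hexh ha hb _ hK₁ hrsub
  have hK₁ev := hexh _ hK₁ hrsub
  have hsmall : ∀ᶠ δ : ℝ in 𝓝[>] 0, δ ≤ r / 2 :=
    (eventually_le_nhds (show (0 : ℝ) < r / 2 by positivity)).filter_mono nhdsWithin_le_nhds
  have hpos : ∀ᶠ δ : ℝ in 𝓝[>] 0, 0 < δ := eventually_mem_nhdsWithin
  set Cd : ℝ := max C_D 0 with hCd
  set Cm : ℝ := max C_M 0 with hCm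
  have hCd0 : 0 ≤ Cd := le_max_right _ _
  have hCm0 : 0 ≤ Cm := le_max_right _ _
  -- the majorant
  have hg : Tendsto (fun δ : ℝ => Cm * (2 * Mψ * (Cd * (2 / r) ^ θ) * δ ^ (θ - 3 / 4) +
      (Lψ : ℝ) / 2 * δ ^ (1 / 4 : ℝ))) (𝓝[>] 0) (𝓝 0) := by
    have h1 := tendsto_rpow_nhdsGT_zero (show 0 < θ - 3 / 4 by linarith)
    have h2 := tendsto_rpow_nhdsGT_zero (show (0 : ℝ) < 1 / 4 by norm_num)
    have h := ((h1.const_mul (2 * Mψ * (Cd * (2 / r) ^ θ))).add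
      (h2.const_mul ((Lψ : ℝ) / 2))).const_mul Cm
    rw [show Cm * (2 * Mψ * (Cd * (2 / r) ^ θ) * 0 + (Lψ : ℝ) / 2 * 0) = 0 by ring] at h
    exact h
  refine squeeze_zero_norm' ?_ hg
  filter_upwards [hev, hMR, hK₁ev, hsmall, hpos] with δ hevδ hMRδ hexδ hδr hδ
  obtain ⟨hsc, haδ, hbδ, -, -, -, -⟩ := hevδ
  -- the root as an explicit boundary edge
  obtain ⟨hae, u, w, hauw, hw, hu⟩ := haδ
  have hrig := hW (Λ δ) hsc (a δ) ⟨hae, u, w, hauw, hw, hu⟩ (b δ) hbδ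
  rw [hauw] at hae hrig
  have huw : hexGraph.Adj u w := (SimpleGraph.mem_edgeSet _).1 hae
  rw [hauw] at hMRδ ⊢
  -- positivity of the fugacity
  have hxc : 0 ≤ hexCriticalFugacity := hexCriticalFugacity_pos_lt_one.1.le
  -- nonnegativity of the majorant at `δ`
  have hgδ : 0 ≤ Cm * (2 * Mψ * (Cd * (2 / r) ^ θ) * δ ^ (θ - 3 / 4) +
      (Lψ : ℝ) / 2 * δ ^ (1 / 4 : ℝ)) := by
    have h1 : 0 ≤ δ ^ (θ - 3 / 4) := Real.rpow_nonneg hδ.le _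
    have h2 : 0 ≤ δ ^ (1 / 4 : ℝ) := Real.rpow_nonneg hδ.le _
    have h3 : 0 ≤ (2 / r) ^ θ := Real.rpow_nonneg (by positivity) _
    positivity
  -- depth radius
  set R : ℝ := r / (2 * δ) with hR
  have hR0 : 0 < R := by positivity
  have hR1 : 1 ≤ R := by
    rw [hR, le_div_iff₀ (by positivity)]; linarith
  have hRθ : R ^ (-θ) = (2 / r) ^ θ * δ ^ θ := by
    rw [Real.rpow_neg hR0.le, ← Real.inv_rpow hR0.le, hR, inv_div,
      show 2 * δ / r = 2 / r * δ by ring, Real.mul_rpow (by positivity) hδ.le]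
  -- the vertex-star defect bound from `DefectDecoherence`
  have hT : ∀ v ∈ Λ δ, v.2 = 0 → (δ : ℂ) * hexCenter v ∈ tsupport ψ →
      ‖∑ t ∈ (Λ δ).filter (fun t => hexGraph.Adj v t),
          (starRingEnd ℂ) (hexMidpoint s(v, t) - hexCenter v) *
            hexParafermionicObservable (Λ δ) s(u, w) hexCriticalFugacity (5 / 8) s(v, t)‖ ≤
        Cd * R ^ (-θ) * ∑ t ∈ (Λ δ).filter (fun t => hexGraph.Adj v t),
          ‖hexParafermionicObservable (Λ δ) s(u, w) hexCriticalFugacity 0 s(v, t)‖ := by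
    intro v _ _ hvs
    have hdeep : ∀ y : HexVertex, dist (hexCenter y) (hexCenter v) ≤ R → y ∈ Λ δ := by
      intro y hy
      refine hexδ y (mem_of_dist_le_of_mem_tsupport subset_rfl hvs ?_)
      rw [dist_eq_norm, ← mul_sub, norm_mul, Complex.norm_real, Real.norm_of_nonneg hδ.le,
        ← dist_eq_norm]
      calc δ * dist (hexCenter y) (hexCenter v) ≤ δ * R := mul_le_mul_of_nonneg_left hy hδ.le
        _ = r / 2 := by rw [hR]; field_simp
        _ ≤ r := by linarith
    refine (hDD (Λ δ) hsc u w huw hu hw v R hR1 hdeep).trans ?_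
    refine mul_le_mul_of_nonneg_right ?_ (Finset.sum_nonneg fun t _ => norm_nonneg _)
    exact mul_le_mul_of_nonneg_right (le_max_left _ _) (Real.rpow_nonneg hR0.le _)
  -- the domain bound
  have hS := domain_bound hMψ hLψ hδ (by linarith) subset_rfl
    (fun e => hexParafermionicObservable (Λ δ) s(u, w) hexCriticalFugacity (5 / 8) e)
    (fun e => ‖hexParafermionicObservable (Λ δ) s(u, w) hexCriticalFugacity 0 e‖)
    (fun e => norm_nonneg _) (fun e => norm_obs_le_norm_obs_zero _ _ hxc _ e) (Λ δ) hexδ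
    (c := Cd * R ^ (-θ)) (by positivity) hT
  beta_reduce at hS
  -- rigidity: `‖F(b)‖ = Z(b)`
  have hFZ := norm_obs_eq_of_winding_eq (Λ δ) s(u, w) (b δ) hexCriticalFugacity (5 / 8) hrig
  -- abbreviations
  set S : ℂ := ∑ᶠ p ∈ {p : HexVertex × HexVertex | s(p.1, p.2) ∈ hexDomainMidEdges (Λ δ) ∧ p.1.2 = 0}, ψ ((δ : ℂ) * hexMidpoint s(p.1, p.2)) *
      (starRingEnd ℂ) (hexCenter p.2 - hexCenter p.1) *
        hexParafermionicObservable (Λ δ) s(u, w) hexCriticalFugacity (5 / 8) s(p.1, p.2) with hSdef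
  set W : ℝ := ∑ᶠ e ∈ {e | e ∈ hexDomainMidEdges (Λ δ) ∧
      (δ : ℂ) * hexMidpoint e ∈ cthickening r (tsupport ψ)},
        ‖hexParafermionicObservable (Λ δ) s(u, w) hexCriticalFugacity 0 e‖ with hWdef
  set Fb : ℂ := hexParafermionicObservable (Λ δ) s(u, w) hexCriticalFugacity (5 / 8) (b δ) with hFb
  set Zb : ℝ := ‖hexParafermionicObservable (Λ δ) s(u, w) hexCriticalFugacity 0 (b δ)‖ with hZb
  have hW0 : 0 ≤ W := by
    rw [hWdef]; exact finsum_nonneg fun e => finsum_nonneg fun _ => norm_nonneg _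
  -- `MassRatio` with a nonnegative constant
  have hMR' : δ ^ 2 * W ≤ Cm * δ ^ (-(3 : ℝ) / 4) * Zb := by
    refine hMRδ.trans (mul_le_mul_of_nonneg_right ?_ (norm_nonneg _))
    exact mul_le_mul_of_nonneg_right (le_max_left _ _) (Real.rpow_nonneg hδ.le _)
  -- exponent algebra
  have key : (2 * Mψ * (Cd * R ^ (-θ)) + Lψ * δ / 2) * (Cm * δ ^ (-(3 : ℝ) / 4)) =
      Cm * (2 * Mψ * (Cd * (2 / r) ^ θ) * δ ^ (θ - 3 / 4) + (Lψ : ℝ) / 2 * δ ^ (1 / 4 : ℝ)) := by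
    have h1 : δ ^ (θ - 3 / 4) = δ ^ θ * δ ^ (-(3 : ℝ) / 4) := by
      rw [← Real.rpow_add hδ]; congr 1; ring
    have h2 : δ ^ (1 / 4 : ℝ) = δ * δ ^ (-(3 : ℝ) / 4) := by
      conv_rhs => rw [← Real.rpow_one δ, ← Real.rpow_mul hδ.le, one_mul, ← Real.rpow_add hδ]
      congr 1; norm_num
    rw [hRθ, h1, h2]; ring
  -- the quotient
  change ‖(δ : ℂ) ^ 2 * S / Fb‖ ≤ _
  by_cases hFb0 : Fb = 0
  · rw [hFb0, div_zero, norm_zero]; exact hgδ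
  have hFbpos : 0 < ‖Fb‖ := norm_pos_iff.2 hFb0
  rw [norm_div, norm_mul, norm_pow, Complex.norm_real, Real.norm_of_nonneg hδ.le,
    div_le_iff₀ hFbpos, ← key]
  calc δ ^ 2 * ‖S‖ ≤ δ ^ 2 * ((2 * Mψ * (Cd * R ^ (-θ)) + Lψ * δ / 2) * W) :=
        mul_le_mul_of_nonneg_left hS (by positivity)
    _ = (2 * Mψ * (Cd * R ^ (-θ)) + Lψ * δ / 2) * (δ ^ 2 * W) := by ring
    _ ≤ (2 * Mψ * (Cd * R ^ (-θ)) + Lψ * δ / 2) * (Cm * δ ^ (-(3 : ℝ) / 4) * Zb) := by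
        refine mul_le_mul_of_nonneg_left hMR' ?_
        have : 0 ≤ R ^ (-θ) := Real.rpow_nonneg hR0.le _
        positivity
    _ = (2 * Mψ * (Cd * R ^ (-θ)) + Lψ * δ / 2) * (Cm * δ ^ (-(3 : ℝ) / 4)) * ‖Fb‖ := by
        rw [← hFZ, hFb]; ring

/-- **`DecoherenceSynthesis`** (item `stmt-CriticalPhenomena-8558`) — the glue statement of the
route file by name: `BoundaryWindingRigidity → DefectDecoherence → MassRatio →
ConjugateClassNegligible` (proved from `conjugateClassNegligible_of_cruxes`). -/
theorem decoherenceSynthesis_proof : DecoherenceSynthesis :=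
  fun hW hD hM => conjugateClassNegligible_of_cruxes hW hD hM

end Summit.CriticalPhenomena.SAWScalingLimit.Theorems
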